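import Mathlib.Data.Real.Basic
import Mathlib.Tactic.Linarith
import Mathlib.Tactic.Ring
import Summits.CriticalPhenomena.PercolationContinuityZ3.Theorems.PercNearOneGluingNoHeavyLowerTailThreePointLBSwitchingCertificate
import HarnessLib

/-!
# `NoHeavyLowerTail` (stmt-CriticalPhenomena-4575) — `T_inc` by five switchings, II: the finite certificate check and the cubic identity

Support file (prover prim-e3grp-switch-1; `--supports stmt-CriticalPhenomena-4575`).  No named facts, no sorries; graph-free.

The two graph-free ingredients of prim-e3grp-switch-1's proof of
`T_inc = E₃({a↔b}∪{a↔c}, {a↔b}∪{b↔c}, {a↔c}∪{b↔c}) ≥ 0` (PROOF-TINC.md, certificate "I5", 2026-08-20):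
* `certB_nonpos` / `certP_nonpos` — the pointwise lemma in abstract form: after the sealed-cluster rewriting rules of
  `…ThreePointLBSwitching` the sum `S = λ₀ + Σᵢ λᵢ∘Ψᵢ` is a signed sum of ten indicator monomials in NINETEEN atomic
  connection statements (`xab xac xbc` in copy `X`, `yab yac` in `Y`, `zab zbc` in `Z`, the avoiding-paths `ap =
  [a~b by Y-pairs avoiding cl X c]`, `bp = [b~c by Z-pairs avoiding cl X a]`, `kp = [a~b by Z-pairs avoiding cl X c]`,
  and nine connections inside the partially exchanged outputs `p2 p3 p4 m3a m3b m4a m4b m5a m5b`), subject to twenty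
  implications supplied by F1–F4/F3′/transitivity; on all `2¹⁹` Boolean patterns satisfying them the sum is `≤ 0` (`decide`).
* `cert_identity` — with `q + u_a + u_b + u_c + t = 1` the ten expectations sum to `−T_inc = −((1+q)(qt − e₂(u)) − e₃(u))`.
-/

noncomputable section

namespace Summit.CriticalPhenomena.PercolationContinuityZ3.Theorems

namespace TIncSwitching

open ThreePointLB

/-- The pointwise certificate of `T_inc` as a function of the 19 Boolean atoms (see `cert_nonpos`); the `∧/∨` structure is
exactly the one produced by the rewriting `simp` of file III. [this work] -/
def certB (xab xac xbc yab yac zab zbc ap bp kp p2 p3 p4 m3a m3b m4a m4b m5a m5b : Bool) : ℤ :=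
  - bI (!(yac && !yab) && (!xab && (!xac && !(xab && xac || !xab && bp))))
  - bI ((!yab && !yac) && ((xab && xac || !xab && bp) && !xab))
  + bI (!p2 && ((!yab && !yac) && ((xac && xbc || !xac && kp) && !xac)))
  + bI (!p3 && ((!yab && !yac) && (!m3a && !m3b)))
  + bI (!p4 && ((!m4a && !m4b) && !zbc))
  + bI (((xac && xbc || !xac && ap) && !xac) && (!m5a && !m5b))
  + bI ((xbc && !xab) && (yab && !zbc))
  + bI ((xbc && !xab) && ((!yab && !yac) && zbc))
  - bI ((xac && !xab) && ((!yab && !yac) && (!zab && !zbc)))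
  - bI ((!xab && (!xac && !xbc)) && (!yab && !zbc))

set_option synthInstance.maxHeartbeats 400000 in
set_option synthInstance.maxSize 4096 in
set_option maxHeartbeats 4000000 in
/-- Case `(xab, xac, xbc) = (false, false, false)` of `certB_nonpos` (`2¹⁶` patterns, `decide`). [this work] -/
theorem certB_nonpos_fff : ∀ yab yac zab zbc ap bp kp p2 p3 p4 m3a m3b m4a m4b m5a m5b : Bool,
    (false = true → false = true → false = true) → (ap = true → yab = true) → (bp = true → zbc = true) →
    (false = false → false = true → p2 = true) →
    (false = true → p3 = false) → (false = true → m3a = zab) → (false = true → m3b = zbc) →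
    (false = false → false = true → p3 = true) → (false = false → false = true → m3b = true) → (kp = true → m3a = true) →
    (false = true → p4 = false) → (false = true → m4a = yab) → (false = true → m4b = yac) →
    (false = false → false = true → p4 = true) → (false = false → false = true → m4b = true) → (false = false → ap = true → m4a = true) →
    (false = false → false = true → m5a = true) → (bp = true → m5b = true) →
    (false = false → kp = true → false = false) → (false = false → ap = true → false = false) →
    certB false false false yab yac zab zbc ap bp kp p2 p3 p4 m3a m3b m4a m4b m5a m5b ≤ 0 := by
  decide +kernel

set_option synthInstance.maxHeartbeats 400000 in
set_option synthInstance.maxSize 4096 in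
set_option maxHeartbeats 4000000 in
/-- Case `(xab, xac, xbc) = (false, false, true)` of `certB_nonpos` (`2¹⁶` patterns, `decide`). [this work] -/
theorem certB_nonpos_fft : ∀ yab yac zab zbc ap bp kp p2 p3 p4 m3a m3b m4a m4b m5a m5b : Bool,
    (false = true → true = true → false = true) → (ap = true → yab = true) → (bp = true → zbc = true) →
    (false = false → false = true → p2 = true) →
    (false = true → p3 = false) → (false = true → m3a = zab) → (false = true → m3b = zbc) →
    (false = false → false = true → p3 = true) → (false = false → true = true → m3b = true) → (kp = true → m3a = true) →
    (true = true → p4 = false) → (true = true → m4a = yab) → (true = true → m4b = yac) →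
    (true = false → false = true → p4 = true) → (true = false → false = true → m4b = true) → (true = false → ap = true → m4a = true) →
    (false = false → false = true → m5a = true) → (bp = true → m5b = true) →
    (false = false → kp = true → true = false) → (false = false → ap = true → true = false) →
    certB false false true yab yac zab zbc ap bp kp p2 p3 p4 m3a m3b m4a m4b m5a m5b ≤ 0 := by
  decide +kernel

set_option synthInstance.maxHeartbeats 400000 in
set_option synthInstance.maxSize 4096 in
set_option maxHeartbeats 4000000 in
/-- Case `(xab, xac, xbc) = (false, true, false)` of `certB_nonpos` (`2¹⁶` patterns, `decide`). [this work] -/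
theorem certB_nonpos_ftf : ∀ yab yac zab zbc ap bp kp p2 p3 p4 m3a m3b m4a m4b m5a m5b : Bool,
    (true = true → false = true → false = true) → (ap = true → yab = true) → (bp = true → zbc = true) →
    (true = false → false = true → p2 = true) →
    (true = true → p3 = false) → (true = true → m3a = zab) → (true = true → m3b = zbc) →
    (true = false → false = true → p3 = true) → (true = false → false = true → m3b = true) → (kp = true → m3a = true) →
    (false = true → p4 = false) → (false = true → m4a = yab) → (false = true → m4b = yac) →
    (false = false → false = true → p4 = true) → (false = false → true = true → m4b = true) → (false = false → ap = true → m4a = true) →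
    (true = false → false = true → m5a = true) → (bp = true → m5b = true) →
    (true = false → kp = true → false = false) → (true = false → ap = true → false = false) →
    certB false true false yab yac zab zbc ap bp kp p2 p3 p4 m3a m3b m4a m4b m5a m5b ≤ 0 := by
  decide +kernel

set_option synthInstance.maxHeartbeats 400000 in
set_option synthInstance.maxSize 4096 in
set_option maxHeartbeats 4000000 in
/-- Case `(xab, xac, xbc) = (false, true, true)` of `certB_nonpos` (`2¹⁶` patterns, `decide`). [this work] -/
theorem certB_nonpos_ftt : ∀ yab yac zab zbc ap bp kp p2 p3 p4 m3a m3b m4a m4b m5a m5b : Bool,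
    (true = true → true = true → false = true) → (ap = true → yab = true) → (bp = true → zbc = true) →
    (true = false → false = true → p2 = true) →
    (true = true → p3 = false) → (true = true → m3a = zab) → (true = true → m3b = zbc) →
    (true = false → false = true → p3 = true) → (true = false → true = true → m3b = true) → (kp = true → m3a = true) →
    (true = true → p4 = false) → (true = true → m4a = yab) → (true = true → m4b = yac) →
    (true = false → false = true → p4 = true) → (true = false → true = true → m4b = true) → (true = false → ap = true → m4a = true) →
    (true = false → false = true → m5a = true) → (bp = true → m5b = true) →
    (true = false → kp = true → true = false) → (true = false → ap = true → true = false) →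
    certB false true true yab yac zab zbc ap bp kp p2 p3 p4 m3a m3b m4a m4b m5a m5b ≤ 0 := by
  decide +kernel

set_option synthInstance.maxHeartbeats 400000 in
set_option synthInstance.maxSize 4096 in
set_option maxHeartbeats 4000000 in
/-- Case `(xab, xac, xbc) = (true, false, false)` of `certB_nonpos` (`2¹⁶` patterns, `decide`). [this work] -/
theorem certB_nonpos_tff : ∀ yab yac zab zbc ap bp kp p2 p3 p4 m3a m3b m4a m4b m5a m5b : Bool,
    (false = true → false = true → true = true) → (ap = true → yab = true) → (bp = true → zbc = true) →
    (false = false → true = true → p2 = true) →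
    (false = true → p3 = true) → (false = true → m3a = zab) → (false = true → m3b = zbc) →
    (false = false → true = true → p3 = true) → (false = false → false = true → m3b = true) → (kp = true → m3a = true) →
    (false = true → p4 = true) → (false = true → m4a = yab) → (false = true → m4b = yac) →
    (false = false → true = true → p4 = true) → (false = false → false = true → m4b = true) → (false = false → ap = true → m4a = true) →
    (false = false → true = true → m5a = true) → (bp = true → m5b = true) →
    (false = false → kp = true → false = false) → (false = false → ap = true → false = false) →
    certB true false false yab yac zab zbc ap bp kp p2 p3 p4 m3a m3b m4a m4b m5a m5b ≤ 0 := by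
  decide +kernel

set_option synthInstance.maxHeartbeats 400000 in
set_option synthInstance.maxSize 4096 in
set_option maxHeartbeats 4000000 in
/-- Case `(xab, xac, xbc) = (true, false, true)` of `certB_nonpos` (`2¹⁶` patterns, `decide`). [this work] -/
theorem certB_nonpos_tft : ∀ yab yac zab zbc ap bp kp p2 p3 p4 m3a m3b m4a m4b m5a m5b : Bool,
    (false = true → true = true → true = true) → (ap = true → yab = true) → (bp = true → zbc = true) →
    (false = false → true = true → p2 = true) →
    (false = true → p3 = true) → (false = true → m3a = zab) → (false = true → m3b = zbc) →
    (false = false → true = true → p3 = true) → (false = false → true = true → m3b = true) → (kp = true → m3a = true) →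
    (true = true → p4 = true) → (true = true → m4a = yab) → (true = true → m4b = yac) →
    (true = false → true = true → p4 = true) → (true = false → false = true → m4b = true) → (true = false → ap = true → m4a = true) →
    (false = false → true = true → m5a = true) → (bp = true → m5b = true) →
    (false = false → kp = true → true = false) → (false = false → ap = true → true = false) →
    certB true false true yab yac zab zbc ap bp kp p2 p3 p4 m3a m3b m4a m4b m5a m5b ≤ 0 := by
  decide +kernel

set_option synthInstance.maxHeartbeats 400000 in
set_option synthInstance.maxSize 4096 in
set_option maxHeartbeats 4000000 in
/-- Case `(xab, xac, xbc) = (true, true, false)` of `certB_nonpos` (`2¹⁶` patterns, `decide`). [this work] -/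
theorem certB_nonpos_ttf : ∀ yab yac zab zbc ap bp kp p2 p3 p4 m3a m3b m4a m4b m5a m5b : Bool,
    (true = true → false = true → true = true) → (ap = true → yab = true) → (bp = true → zbc = true) →
    (true = false → true = true → p2 = true) →
    (true = true → p3 = true) → (true = true → m3a = zab) → (true = true → m3b = zbc) →
    (true = false → true = true → p3 = true) → (true = false → false = true → m3b = true) → (kp = true → m3a = true) →
    (false = true → p4 = true) → (false = true → m4a = yab) → (false = true → m4b = yac) →
    (false = false → true = true → p4 = true) → (false = false → true = true → m4b = true) → (false = false → ap = true → m4a = true) →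
    (true = false → true = true → m5a = true) → (bp = true → m5b = true) →
    (true = false → kp = true → false = false) → (true = false → ap = true → false = false) →
    certB true true false yab yac zab zbc ap bp kp p2 p3 p4 m3a m3b m4a m4b m5a m5b ≤ 0 := by
  decide +kernel

set_option synthInstance.maxHeartbeats 400000 in
set_option synthInstance.maxSize 4096 in
set_option maxHeartbeats 4000000 in
/-- Case `(xab, xac, xbc) = (true, true, true)` of `certB_nonpos` (`2¹⁶` patterns, `decide`). [this work] -/
theorem certB_nonpos_ttt : ∀ yab yac zab zbc ap bp kp p2 p3 p4 m3a m3b m4a m4b m5a m5b : Bool,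
    (true = true → true = true → true = true) → (ap = true → yab = true) → (bp = true → zbc = true) →
    (true = false → true = true → p2 = true) →
    (true = true → p3 = true) → (true = true → m3a = zab) → (true = true → m3b = zbc) →
    (true = false → true = true → p3 = true) → (true = false → true = true → m3b = true) → (kp = true → m3a = true) →
    (true = true → p4 = true) → (true = true → m4a = yab) → (true = true → m4b = yac) →
    (true = false → true = true → p4 = true) → (true = false → true = true → m4b = true) → (true = false → ap = true → m4a = true) →
    (true = false → true = true → m5a = true) → (bp = true → m5b = true) →
    (true = false → kp = true → true = false) → (true = false → ap = true → true = false) →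
    certB true true true yab yac zab zbc ap bp kp p2 p3 p4 m3a m3b m4a m4b m5a m5b ≤ 0 := by
  decide +kernel

/-- **The certificate is pointwise nonpositive** on every Boolean pattern of the 19 atoms compatible with the twenty
implications supplied by the cluster facts (`2¹⁹` cases, by `decide` in eight slices). [this work] -/
theorem certB_nonpos : ∀ xab xac xbc yab yac zab zbc ap bp kp p2 p3 p4 m3a m3b m4a m4b m5a m5b : Bool,
    (xac = true → xbc = true → xab = true) → (ap = true → yab = true) → (bp = true → zbc = true) →
    (xac = false → xab = true → p2 = true) →
    (xac = true → p3 = xab) → (xac = true → m3a = zab) → (xac = true → m3b = zbc) →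
    (xac = false → xab = true → p3 = true) → (xac = false → xbc = true → m3b = true) → (kp = true → m3a = true) →
    (xbc = true → p4 = xab) → (xbc = true → m4a = yab) → (xbc = true → m4b = yac) →
    (xbc = false → xab = true → p4 = true) → (xbc = false → xac = true → m4b = true) → (xbc = false → ap = true → m4a = true) →
    (xac = false → xab = true → m5a = true) → (bp = true → m5b = true) →
    (xac = false → kp = true → xbc = false) → (xac = false → ap = true → xbc = false) →
    certB xab xac xbc yab yac zab zbc ap bp kp p2 p3 p4 m3a m3b m4a m4b m5a m5b ≤ 0 := by
  intro xab xac xbc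
  cases xab <;> cases xac <;> cases xbc
  · exact certB_nonpos_fff
  · exact certB_nonpos_fft
  · exact certB_nonpos_ftf
  · exact certB_nonpos_ftt
  · exact certB_nonpos_tff
  · exact certB_nonpos_tft
  · exact certB_nonpos_ttf
  · exact certB_nonpos_ttt

/-- **Pointwise lemma, propositional form**: for any nineteen propositions satisfying the twenty implications, the certificate
expression is `≤ 0`. [this work] -/
theorem certP_nonpos (xab xac xbc yab yac zab zbc ap bp kp p2 p3 p4 m3a m3b m4a m4b m5a m5b : Prop)
    (h1 : xac → xbc → xab) (h2 : ap → yab) (h3 : bp → zbc) (h4 : ¬xac → xab → p2)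
    (h5 : xac → (p3 ↔ xab)) (h6 : xac → (m3a ↔ zab)) (h7 : xac → (m3b ↔ zbc))
    (h8 : ¬xac → xab → p3) (h9 : ¬xac → xbc → m3b) (h10 : kp → m3a)
    (h11 : xbc → (p4 ↔ xab)) (h12 : xbc → (m4a ↔ yab)) (h13 : xbc → (m4b ↔ yac))
    (h14 : ¬xbc → xab → p4) (h15 : ¬xbc → xac → m4b) (h16 : ¬xbc → ap → m4a)
    (h17 : ¬xac → xab → m5a) (h18 : bp → m5b) (h19 : ¬xac → kp → ¬xbc) (h20 : ¬xac → ap → ¬xbc) :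
    -pind (¬(yac ∧ ¬yab) ∧ ¬xab ∧ ¬xac ∧ ¬(xab ∧ xac ∨ ¬xab ∧ bp))
    - pind ((¬yab ∧ ¬yac) ∧ (xab ∧ xac ∨ ¬xab ∧ bp) ∧ ¬xab)
    + pind (¬p2 ∧ (¬yab ∧ ¬yac) ∧ (xac ∧ xbc ∨ ¬xac ∧ kp) ∧ ¬xac)
    + pind (¬p3 ∧ (¬yab ∧ ¬yac) ∧ ¬m3a ∧ ¬m3b)
    + pind (¬p4 ∧ (¬m4a ∧ ¬m4b) ∧ ¬zbc)
    + pind (((xac ∧ xbc ∨ ¬xac ∧ ap) ∧ ¬xac) ∧ ¬m5a ∧ ¬m5b)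
    + pind ((xbc ∧ ¬xab) ∧ yab ∧ ¬zbc)
    + pind ((xbc ∧ ¬xab) ∧ (¬yab ∧ ¬yac) ∧ zbc)
    - pind ((xac ∧ ¬xab) ∧ (¬yab ∧ ¬yac) ∧ ¬zab ∧ ¬zbc)
    - pind ((¬xab ∧ ¬xac ∧ ¬xbc) ∧ ¬yab ∧ ¬zbc) ≤ 0 := by
  classical
  have key := certB_nonpos (decide xab) (decide xac) (decide xbc) (decide yab) (decide yac) (decide zab) (decide zbc)
      (decide ap) (decide bp) (decide kp) (decide p2) (decide p3) (decide p4) (decide m3a) (decide m3b) (decide m4a)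
      (decide m4b) (decide m5a) (decide m5b)
      (by simpa only [decide_eq_true_eq] using h1) (by simpa only [decide_eq_true_eq] using h2)
      (by simpa only [decide_eq_true_eq] using h3)
      (by simpa only [decide_eq_true_eq, decide_eq_false_iff_not] using h4)
      (by intro h; rw [decide_eq_true_eq] at h; exact (decide_eq_decide).2 (h5 h))
      (by intro h; rw [decide_eq_true_eq] at h; exact (decide_eq_decide).2 (h6 h))
      (by intro h; rw [decide_eq_true_eq] at h; exact (decide_eq_decide).2 (h7 h))
      (by simpa only [decide_eq_true_eq, decide_eq_false_iff_not] using h8)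
      (by simpa only [decide_eq_true_eq, decide_eq_false_iff_not] using h9)
      (by simpa only [decide_eq_true_eq] using h10)
      (by intro h; rw [decide_eq_true_eq] at h; exact (decide_eq_decide).2 (h11 h))
      (by intro h; rw [decide_eq_true_eq] at h; exact (decide_eq_decide).2 (h12 h))
      (by intro h; rw [decide_eq_true_eq] at h; exact (decide_eq_decide).2 (h13 h))
      (by simpa only [decide_eq_true_eq, decide_eq_false_iff_not] using h14)
      (by simpa only [decide_eq_true_eq, decide_eq_false_iff_not] using h15)
      (by simpa only [decide_eq_true_eq, decide_eq_false_iff_not] using h16)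
      (by simpa only [decide_eq_true_eq, decide_eq_false_iff_not] using h17)
      (by simpa only [decide_eq_true_eq] using h18)
      (by simpa only [decide_eq_true_eq, decide_eq_false_iff_not] using h19)
      (by simpa only [decide_eq_true_eq, decide_eq_false_iff_not] using h20)
  rw [pind_eq_bI, pind_eq_bI, pind_eq_bI, pind_eq_bI, pind_eq_bI, pind_eq_bI, pind_eq_bI, pind_eq_bI, pind_eq_bI,
    pind_eq_bI]
  simp only [Bool.decide_and, Bool.decide_or, decide_not]
  unfold certB at key
  exact_mod_cast key

/-! ### The cubic identity -/

/-- The cubic identity `Σ_i E[λ_i] = −T_inc` (PROOF-TINC.md, IDENTITY (I) for certificate I5), as a polynomial identity in the five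
cell probabilities with `q + u_a + u_b + u_c + t = 1`. [this work] -/
theorem cert_identity (q ua ub uc t : ℝ) (h : q + ua + ub + uc + t = 1) :
    -(1 * (1 - ub) * q) - 1 * (q + ua) * ua + (q + ua + ub) * (q + ua) * uc + (q + ua + ub) * (q + ua) * (q + ub)
      + (q + ua + ub) * (q + ua) * (q + ub + uc) + 1 * uc * (q + ub)
      + ua * (uc + t) * (q + ub + uc) + ua * (q + ua) * (ua + t) - ub * (q + ua) * (q + ub) - q * (q + ua + ub) * (q + ub + uc) =
    -((1 + q) * (q * t - (uc * ub + uc * ua + ub * ua)) - uc * ub * ua) := by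
  have ht : t = 1 - q - ua - ub - uc := by linarith
  subst ht
  ring

end TIncSwitching

end Summit.CriticalPhenomena.PercolationContinuityZ3.Theorems

end
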